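import Summits.QuantumFields.QCD.Theses.PauliWegnerSea
import Literature.MathematicalPhysics.QuantumFieldTheory.QCDPhaseQuenched
import Literature.MathematicalPhysics.QuantumFieldTheory.QCDPhaseQuenchedPositivity
import Literature.MathematicalPhysics.QuantumFieldTheory.QCDPhaseQuenchedReweighting
import Literature.MathematicalPhysics.QuantumFieldTheory.QCDPhaseQuenchedMomentUpgrade
import Literature.MathematicalPhysics.QuantumFieldTheory.QCDWickMinorMeasurability
import Literature.MeasureTheory.Integral.WeightedLyapunovNegativeMoment

/-!
# Stub `stub_powerMeanSandwich` of line `adjugate-anticoncentration-pin`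
(crux `Summit.QuantumFields.QCD.Theses.PauliWegnerSea.OneScaleTrajectory`,
item stmt-QuantumFields-11513)

## What is proved

The power-mean sandwich (D) of the line: along a one-scale lattice-QCD trajectory
(`reg : QCDRegularisation Nf`, bare masses `m_f(k) = m_crit(k) + a_k m_f / Z_m(k)`, Wilson measure
`μ_W = wilsonMeasure (fundamentalRep (Fin 3)) (β k)` on the torus of side `2S+1`), write
`w(U) = |det D(U)|` for the phase-quenched weight and
`X(U) = Σ_{a,i,b,j} |D(U)⁻¹((f,0,a,i),(f,n e₀,b,j))|` for the colour–spin entry sum of the quark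
propagator between time-separated sites.  IF eventually in `k` the weighted NEGATIVE moment obeys
the harmonic pin
`∫ w X^{-r} dμ_W ≤ c (1+|β_k|)^P e^{r (C₁ a_k n + p log (n+1))} ∫ w dμ_W` (`r, c > 0`),
THEN for every `κ > 0` and `0 < s < 1` there are `c₀ > 0`, `C₁'`, `p'` with, eventually in `k`, on
the far window `(1+|β_k|)^κ ≤ n+1`:
`c₀ e^{-(C₁' a_k n + p' log (n+1))} ≤ ∫ w X^s dμ_W / ∫ w dμ_W = ⟨X^s⟩₊`
(the phase-quenched fractional moment of clause (iii) of the crux).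

## Proof

Monotonicity of power means (Lyapunov; Hardy–Littlewood–Pólya, *Inequalities*, Thm 16): under the
probability `w dμ_W / ∫ w`, `E[X^s] ≥ E[X^{-r}]^{-s/r}`.  In the junk-free `ℝ≥0∞` form this is
`Literature.MeasureTheory.Integral.rpow_neg_mul_integral_le_integral_mul_rpow` (Hölder with the
conjugate pair `(r/(r+s), s/(r+s))`; finiteness of the negative moment forces `w = 0` a.e. on
`{X = 0}`), which needs: `∫ w dμ_W > 0` (`integral_norm_det_diracMatrix_pos_all`), measurability of
`X` (`measurable_inv_diracMatrix_apply`) and integrability of `w X^s` — from `X^s ≤ 1 + X` and the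
bound `w X ≤ Σ |adj D| ≤ C` on the compact configuration space (`norm_det_mul_norm_inv_apply_le`).
This gives `⟨X^s⟩₊ ≥ B_k(n)^{-s/r}` with `B_k(n) = c (1+|β_k|)^P e^{r(…)}`, i.e.
`c^{-s/r} (1+|β_k|)^{-Ps/r} e^{-s C₁ a_k n} (n+1)^{-s p}`.  On the far window the polynomial loss is
absorbed: `(1+|β_k|)^{-Ps/r} ≥ (1+|β_k|)^{-P⁺ s/r} ≥ (n+1)^{-P⁺ s/(rκ)}` (`P⁺ = max P 0`,
`κ log(1+|β_k|) ≤ log(n+1)`), and `s C₁ ≤ max (s C₁) 0`, `s p ≤ max (s p) 0` against the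
non-negative `a_k n`, `log (n+1)`; so `c₀ = c^{-s/r}`, `C₁' = max (s C₁) 0`,
`p' = max (s p) 0 + P⁺ s/(r κ)` work (`farWindow_absorb`).

Sources: G. H. Hardy, J. E. Littlewood, G. Pólya, *Inequalities* (CUP 1952), §2.9 Thm 16 (Lyapunov's
inequality); M. Aizenman, J. Schenker, R. Friedrich, D. Hundertmark, Commun. Math. Phys. 224 (2001)
(fractional-moment bounds from negative moments); I. Montvay, G. Münster, *Quantum Fields on a
Lattice* (CUP 1994), §5.1 (phase-quenched Wilson ensemble). [folklore]
-/

noncomputable section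

namespace Summit.QuantumFields.QCD.Theorems.AdjugateAnticoncentrationPin

open scoped BigOperators ENNReal
open MeasureTheory Filter Set
open Literature.MathematicalPhysics.QuantumFieldTheory Literature.MathematicalPhysics.QuantumLattice
  Literature.Probability.LatticeModels

/-- **The routes' quantity is dominated by adjugate entries.** For the colour–spin entry sum
`X(U) = Σ_{a,i,b,j} |D(U)⁻¹((f,x,a,i),(f,y,b,j))|` of the Wilson quark propagator, the weighted
observable `|det D(U)| · X(U)` is bounded on the (compact) configuration space: entrywise
`|det D| |D⁻¹(p,q)| ≤ |adj D(p,q)|` (`norm_det_mul_norm_inv_apply_le`), a continuous function of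
`U`. [folklore] -/
private theorem exists_bound_norm_det_mul_entrySum {Nf S : ℕ} [NeZero S] (mq : Fin Nf → ℝ)
    (f : Fin Nf) (x y : TorusSite 4 S) :
    ∃ C : ℝ, ∀ U : GaugeConfig 4 S SU3,
      ‖(diracMatrix U mq).det‖ * ∑ a : Fin 3, ∑ i : Fin 4, ∑ b : Fin 3, ∑ j : Fin 4,
        ‖(diracMatrix U mq)⁻¹ (quarkEquiv (f, (x, a, i))) (quarkEquiv (f, (y, b, j)))‖ ≤ C := by
  have hcont : Continuous fun U : GaugeConfig 4 S SU3 =>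
      ∑ a : Fin 3, ∑ i : Fin 4, ∑ b : Fin 3, ∑ j : Fin 4,
        ‖(diracMatrix U mq).adjugate (quarkEquiv (f, (x, a, i))) (quarkEquiv (f, (y, b, j)))‖ := by
    refine continuous_finsetSum _ fun a _ => continuous_finsetSum _ fun i _ =>
      continuous_finsetSum _ fun b _ => continuous_finsetSum _ fun j _ => ?_
    exact (((continuous_diracMatrix (S := S) mq).matrix_adjugate).matrix_elem _ _).norm
  obtain ⟨U₀, -, hU₀⟩ := (isCompact_univ (X := GaugeConfig 4 S SU3)).exists_isMaxOn
    Set.univ_nonempty hcont.continuousOn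
  refine ⟨_, fun U => le_trans ?_ (hU₀ (Set.mem_univ U))⟩
  simp only [Finset.mul_sum]
  exact Finset.sum_le_sum fun a _ => Finset.sum_le_sum fun i _ => Finset.sum_le_sum fun b _ =>
    Finset.sum_le_sum fun j _ => norm_det_mul_norm_inv_apply_le _ _ _

/-- The colour–spin entry sum of the propagator is a measurable function of the gauge field
(`measurable_inv_diracMatrix_apply`). [folklore] -/
private theorem measurable_entrySum {Nf S : ℕ} [NeZero S] (mq : Fin Nf → ℝ) (f : Fin Nf)
    (x y : TorusSite 4 S) :
    Measurable fun U : GaugeConfig 4 S SU3 =>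
      ∑ a : Fin 3, ∑ i : Fin 4, ∑ b : Fin 3, ∑ j : Fin 4,
        ‖(diracMatrix U mq)⁻¹ (quarkEquiv (f, (x, a, i))) (quarkEquiv (f, (y, b, j)))‖ := by
  refine Finset.measurable_sum _ fun a _ => Finset.measurable_sum _ fun i _ =>
    Finset.measurable_sum _ fun b _ => Finset.measurable_sum _ fun j _ => ?_
  exact (measurable_inv_diracMatrix_apply mq _ _).norm

/-- **Integrability of the weighted fractional moment.** If `X ≥ 0` is measurable with
`|det D| · X ≤ C`, then for `0 ≤ s ≤ 1` the weighted observable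
`|det D(U)| · X(U)^s ≤ |det D(U)| (1 + X(U))` is bounded, hence integrable against every finite
measure on configurations. [folklore] -/
private theorem integrable_norm_det_mul_rpow {Nf S : ℕ} [NeZero S] (mq : Fin Nf → ℝ)
    (μ : Measure (GaugeConfig 4 S SU3)) [IsFiniteMeasure μ] {X : GaugeConfig 4 S SU3 → ℝ}
    (hXm : Measurable X) (hX0 : ∀ U, 0 ≤ X U) {C : ℝ}
    (hC : ∀ U, ‖(diracMatrix U mq).det‖ * X U ≤ C) {s : ℝ} (hs : 0 ≤ s) (hs1 : s ≤ 1) :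
    Integrable (fun U => ‖(diracMatrix U mq).det‖ * X U ^ s) μ := by
  obtain ⟨B, hB⟩ := exists_norm_det_diracMatrix_le (S := S) mq
  refine Integrable.of_bound
    ((measurable_norm_det_diracMatrix mq).mul (hXm.pow_const s)).aestronglyMeasurable (B + C)
    (Eventually.of_forall fun U => ?_)
  have h1 : X U ^ s ≤ 1 + X U := by
    rcases le_or_gt (X U) 1 with h | h
    · exact (Real.rpow_le_one (hX0 U) h hs).trans (le_add_of_nonneg_right (hX0 U))
    · calc X U ^ s ≤ X U ^ (1 : ℝ) := Real.rpow_le_rpow_of_exponent_le h.le hs1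
        _ = X U := Real.rpow_one _
        _ ≤ 1 + X U := le_add_of_nonneg_left zero_le_one
  rw [Real.norm_eq_abs, abs_of_nonneg (mul_nonneg (norm_nonneg _) (Real.rpow_nonneg (hX0 U) _))]
  calc ‖(diracMatrix U mq).det‖ * X U ^ s ≤ ‖(diracMatrix U mq).det‖ * (1 + X U) :=
        mul_le_mul_of_nonneg_left h1 (norm_nonneg _)
    _ = ‖(diracMatrix U mq).det‖ + ‖(diracMatrix U mq).det‖ * X U := by ring
    _ ≤ B + C := add_le_add (hB U) (hC U)

/-- **Lyapunov step for the phase-quenched ensemble.** For a measurable observable `X ≥ 0` with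
`|det D| · X` bounded, `0 < r`, `0 < s ≤ 1`, `0 < B`: an upper bound
`∫ |det D| X^{-r} dμ_W ≤ B ∫ |det D| dμ_W` on the weighted negative moment (in `ℝ≥0∞`) gives the
lower bound `B^{-s/r} ≤ ∫ |det D| X^s dμ_W / ∫ |det D| dμ_W = ⟨X^s⟩₊` on the phase-quenched
fractional moment (the denominator is positive at every parameter,
`integral_norm_det_diracMatrix_pos_all`). [folklore] -/
private theorem rpow_neg_le_weightedMoment_div {Nf S : ℕ} [NeZero S] (β : ℝ) (mq : Fin Nf → ℝ)
    {X : GaugeConfig 4 S SU3 → ℝ} (hXm : Measurable X) (hX0 : ∀ U, 0 ≤ X U) {C : ℝ}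
    (hC : ∀ U, ‖(diracMatrix U mq).det‖ * X U ≤ C) {r s B : ℝ} (hr : 0 < r) (hs : 0 < s)
    (hs1 : s ≤ 1) (hB : 0 < B)
    (h : ∫⁻ U, ENNReal.ofReal ‖(diracMatrix U mq).det‖ * ENNReal.ofReal (X U) ^ (-r)
        ∂(wilsonMeasure (d := 4) (L := S) (fundamentalRep (Fin 3)) β) ≤
      ENNReal.ofReal B * ∫⁻ U, ENNReal.ofReal ‖(diracMatrix U mq).det‖
        ∂(wilsonMeasure (d := 4) (L := S) (fundamentalRep (Fin 3)) β)) :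
    B ^ (-(s / r)) ≤
      (∫ U, ‖(diracMatrix U mq).det‖ * X U ^ s
          ∂(wilsonMeasure (d := 4) (L := S) (fundamentalRep (Fin 3)) β)) /
        ∫ U, ‖(diracMatrix U mq).det‖
          ∂(wilsonMeasure (d := 4) (L := S) (fundamentalRep (Fin 3)) β) := by
  rw [le_div_iff₀ (integral_norm_det_diracMatrix_pos_all (S := S) β mq)]
  exact Literature.MeasureTheory.Integral.rpow_neg_mul_integral_le_integral_mul_rpow
    (measurable_norm_det_diracMatrix mq).aemeasurable hXm.aemeasurable (fun U => norm_nonneg _) hX0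
    (integrable_norm_det_diracMatrix mq _) hr hs hB
    (integrable_norm_det_mul_rpow mq _ hXm hX0 hC hs.le hs1) h

/-- The Lyapunov step for the routes' quantity `X = Σ_{a,i,b,j} |D⁻¹((f,x,a,i),(f,y,b,j))|`:
`B^{-s/r} ≤ ⟨X^s⟩₊` from `∫ |det D| X^{-r} dμ_W ≤ B ∫ |det D| dμ_W`. [folklore] -/
private theorem rpow_neg_le_entrySumMoment_div {Nf S : ℕ} [NeZero S] (β : ℝ) (mq : Fin Nf → ℝ)
    (f : Fin Nf) (x y : TorusSite 4 S) {r s B : ℝ} (hr : 0 < r) (hs : 0 < s) (hs1 : s ≤ 1)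
    (hB : 0 < B)
    (h : ∫⁻ U, ENNReal.ofReal ‖(diracMatrix U mq).det‖ *
          ENNReal.ofReal (∑ a : Fin 3, ∑ i : Fin 4, ∑ b : Fin 3, ∑ j : Fin 4,
            ‖(diracMatrix U mq)⁻¹ (quarkEquiv (f, (x, a, i))) (quarkEquiv (f, (y, b, j)))‖) ^ (-r)
        ∂(wilsonMeasure (d := 4) (L := S) (fundamentalRep (Fin 3)) β) ≤
      ENNReal.ofReal B * ∫⁻ U, ENNReal.ofReal ‖(diracMatrix U mq).det‖
        ∂(wilsonMeasure (d := 4) (L := S) (fundamentalRep (Fin 3)) β)) :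
    B ^ (-(s / r)) ≤
      (∫ U, ‖(diracMatrix U mq).det‖ *
          (∑ a : Fin 3, ∑ i : Fin 4, ∑ b : Fin 3, ∑ j : Fin 4,
            ‖(diracMatrix U mq)⁻¹ (quarkEquiv (f, (x, a, i))) (quarkEquiv (f, (y, b, j)))‖) ^ s
          ∂(wilsonMeasure (d := 4) (L := S) (fundamentalRep (Fin 3)) β)) /
        ∫ U, ‖(diracMatrix U mq).det‖
          ∂(wilsonMeasure (d := 4) (L := S) (fundamentalRep (Fin 3)) β) := by
  obtain ⟨C, hC⟩ := exists_bound_norm_det_mul_entrySum mq f x y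
  exact rpow_neg_le_weightedMoment_div β mq (measurable_entrySum mq f x y) (fun U => by positivity)
    hC hr hs hs1 hB h

/-- **Absorbing the polynomial loss on the far window.** For `0 < r, s, κ, c`, `A ≥ 0`, `b ≥ 0`,
`t ≥ 1` with `(1 + b)^κ ≤ t`:
`c^{-s/r} exp(−(max(sC₁,0) A + (max(sp,0) + max(P,0) s/(rκ)) log t))
  ≤ (c (1+b)^P exp(r (C₁ A + p log t)))^{-s/r}`
— since `(1+b)^{-Ps/r} ≥ (1+b)^{-P⁺s/r} ≥ t^{-P⁺ s/(rκ)}` on the window. Elementary. [folklore] -/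
private theorem farWindow_absorb {r s κ c P C₁ p A b t : ℝ} (hr : 0 < r) (hs : 0 < s) (hκ : 0 < κ)
    (hc : 0 < c) (hA : 0 ≤ A) (hb : 0 ≤ b) (ht : 1 ≤ t) (hwin : (1 + b) ^ κ ≤ t) :
    c ^ (-(s / r)) *
        Real.exp (-(max (s * C₁) 0 * A + (max (s * p) 0 + max P 0 * s / (r * κ)) * Real.log t)) ≤
      (c * (1 + b) ^ P * Real.exp (r * (C₁ * A + p * Real.log t))) ^ (-(s / r)) := by
  have hr0 : r ≠ 0 := hr.ne'
  have hκ0 : κ ≠ 0 := hκ.ne'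
  have hb1 : 1 ≤ 1 + b := le_add_of_nonneg_right hb
  have hb0 : 0 < 1 + b := one_pos.trans_le hb1
  have hlogb : 0 ≤ Real.log (1 + b) := Real.log_nonneg hb1
  have hlogt : 0 ≤ Real.log t := Real.log_nonneg ht
  -- the window in logarithmic form: `κ log (1 + b) ≤ log t`
  have hκlog : κ * Real.log (1 + b) ≤ Real.log t := by
    rw [← Real.log_rpow hb0]
    exact Real.log_le_log (Real.rpow_pos_of_pos hb0 κ) hwin
  -- expand the right-hand side as `c^{-s/r} · exp (…)`
  have hrhs : (c * (1 + b) ^ P * Real.exp (r * (C₁ * A + p * Real.log t))) ^ (-(s / r)) =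
      c ^ (-(s / r)) *
        Real.exp (-(s / r * P * Real.log (1 + b) + s * (C₁ * A + p * Real.log t))) := by
    rw [Real.mul_rpow (by positivity) (Real.exp_pos _).le, Real.mul_rpow hc.le (by positivity),
      ← Real.exp_mul, Real.rpow_def_of_pos hb0, ← Real.exp_mul, mul_assoc, ← Real.exp_add]
    congr 2
    field_simp
    ring
  rw [hrhs]
  refine mul_le_mul_of_nonneg_left (Real.exp_le_exp.2 ?_) (Real.rpow_nonneg hc.le _)
  rw [neg_le_neg_iff]
  have h1 : s * (C₁ * A) ≤ max (s * C₁) 0 * A := by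
    rw [← mul_assoc]
    exact mul_le_mul_of_nonneg_right (le_max_left _ _) hA
  have h2 : s * (p * Real.log t) ≤ max (s * p) 0 * Real.log t := by
    rw [← mul_assoc]
    exact mul_le_mul_of_nonneg_right (le_max_left _ _) hlogt
  have h3 : s / r * P * Real.log (1 + b) ≤ max P 0 * s / (r * κ) * Real.log t :=
    calc s / r * P * Real.log (1 + b) ≤ s / r * max P 0 * Real.log (1 + b) :=
          mul_le_mul_of_nonneg_right
            (mul_le_mul_of_nonneg_left (le_max_left _ _) (div_pos hs hr).le) hlogb
      _ = max P 0 * s / (r * κ) * (κ * Real.log (1 + b)) := by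
          field_simp
      _ ≤ max P 0 * s / (r * κ) * Real.log t :=
          mul_le_mul_of_nonneg_left hκlog (by positivity)
  linarith [h1, h2, h3]

/-- **Power-mean sandwich (stub D of line `adjugate-anticoncentration-pin`).** Along a one-scale
lattice-QCD trajectory, an eventual upper bound
`∫ |det D| X^{-r} dμ_W ≤ c (1+|β_k|)^P e^{r(C₁ a_k n + p log(n+1))} ∫ |det D| dμ_W` on the weighted
negative moment of the propagator entry sum `X = Σ_{a,i,b,j} |D⁻¹((f,0,a,i),(f,n e₀,b,j))|` implies,
for every `κ > 0` and `0 < s < 1`, an eventual lower bound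
`c₀ e^{-(C₁' a_k n + p' log(n+1))} ≤ ⟨X^s⟩₊ = ∫ |det D| X^s dμ_W / ∫ |det D| dμ_W` on the far window
`(1+|β_k|)^κ ≤ n+1` — Lyapunov's inequality `E[X^s] ≥ E[X^{-r}]^{-s/r}` for the `|det D|`-reweighted
Wilson measure, with the polynomial loss `(1+|β_k|)^P` absorbed into `(n+1)^{-p'}`
(Hardy–Littlewood–Pólya, *Inequalities*, Thm 16). [folklore] -/
theorem stub_powerMeanSandwich :
    ∀ (Nf : ℕ) (reg : QCDRegularisation Nf) (m : Fin Nf → ℝ),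
      (∃ r P c C₁ p : ℝ, 0 < r ∧ 0 < c ∧ ∀ᶠ k in atTop, ∀ S : ℕ, reg.L k ≤ S → ∀ (f : Fin Nf) (n : ℕ), n ≤ S →
        ∫⁻ U : GaugeConfig 4 (2 * S + 1) SU3,
            ENNReal.ofReal ‖(diracMatrix U fun fl => reg.mcrit k + reg.a k * m fl / reg.Zm k).det‖ *
              ENNReal.ofReal (∑ a : Fin 3, ∑ i : Fin 4, ∑ b : Fin 3, ∑ j : Fin 4,
                ‖(diracMatrix U fun fl => reg.mcrit k + reg.a k * m fl / reg.Zm k)⁻¹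
                  (quarkEquiv (f, (Torus.proj (2 * S + 1) 0, a, i)))
                  (quarkEquiv (f, (Torus.proj (2 * S + 1) (Pi.single 0 (n : ℤ)), b, j)))‖) ^ (-r)
            ∂(wilsonMeasure (fundamentalRep (Fin 3)) (reg.β k)) ≤
          ENNReal.ofReal (c * (1 + |reg.β k|) ^ P * Real.exp (r * (C₁ * (reg.a k * n) + p * Real.log (n + 1)))) *
            ∫⁻ U : GaugeConfig 4 (2 * S + 1) SU3,
              ENNReal.ofReal ‖(diracMatrix U fun fl => reg.mcrit k + reg.a k * m fl / reg.Zm k).det‖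
              ∂(wilsonMeasure (fundamentalRep (Fin 3)) (reg.β k))) →
      ∀ κ s : ℝ, 0 < κ → 0 < s → s < 1 → ∃ c₀ C₁ p : ℝ, 0 < c₀ ∧ ∀ᶠ k in atTop, ∀ S : ℕ, reg.L k ≤ S →
        ∀ (f : Fin Nf) (n : ℕ), n ≤ S → (1 + |reg.β k|) ^ κ ≤ (n : ℝ) + 1 →
          c₀ * Real.exp (-(C₁ * (reg.a k * n) + p * Real.log (n + 1))) ≤ (∫ U : GaugeConfig 4 (2 * S + 1) (Matrix.specialUnitaryGroup (Fin 3) ℂ), ‖(diracMatrix U fun fl => reg.mcrit k + reg.a k * m fl / reg.Zm k).det‖ * (∑ a : Fin 3, ∑ i : Fin 4, ∑ b : Fin 3, ∑ j : Fin 4, ‖(diracMatrix U fun fl => reg.mcrit k + reg.a k * m fl / reg.Zm k)⁻¹ (quarkEquiv (f, (Torus.proj (2 * S + 1) 0, a, i))) (quarkEquiv (f, (Torus.proj (2 * S + 1) (Pi.single 0 (n : ℤ)), b, j)))‖) ^ s ∂(wilsonMeasure (fundamentalRep (Fin 3)) (reg.β k))) / (∫ U : GaugeConfig 4 (2 * S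 + 1) (Matrix.specialUnitaryGroup (Fin 3) ℂ), ‖(diracMatrix U fun fl => reg.mcrit k + reg.a k * m fl / reg.Zm k).det‖ ∂(wilsonMeasure (fundamentalRep (Fin 3)) (reg.β k))) := by
  intro Nf reg m hH κ s hκ hs hs1
  obtain ⟨r, P, c, C₁, p, hr, hc, hev⟩ := hH
  refine ⟨c ^ (-(s / r)), max (s * C₁) 0, max (s * p) 0 + max P 0 * s / (r * κ),
    Real.rpow_pos_of_pos hc _, ?_⟩
  filter_upwards [hev] with k hk S hS f n hn hwin
  have hB : 0 < c * (1 + |reg.β k|) ^ P *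
      Real.exp (r * (C₁ * (reg.a k * n) + p * Real.log (n + 1))) :=
    mul_pos (mul_pos hc (Real.rpow_pos_of_pos (by positivity) _)) (Real.exp_pos _)
  exact le_trans (farWindow_absorb hr hs hκ hc (mul_nonneg (reg.a_pos k).le n.cast_nonneg)
    (abs_nonneg _) (le_add_of_nonneg_left n.cast_nonneg) hwin)
    (rpow_neg_le_entrySumMoment_div (reg.β k) _ f _ _ hr hs hs1.le hB (hk S hS f n hn))

end Summit.QuantumFields.QCD.Theorems.AdjugateAnticoncentrationPin

end
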